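import Summits.QuantumFields.YangMills.Theorems.BalabanUVNodesPortS1FEInduction
import Summits.QuantumFields.YangMills.Theorems.BalabanUVNodesPortS1JacGlue
import Summits.QuantumFields.YangMills.Theorems.BalabanUVNodesPortRecordRepresentationS1StubLZjacKStep
import Summits.QuantumFields.YangMills.Theorems.BalabanUVNodesPortRecordRepresentationS1StubLZjacDom

/-!
# BalabanUVNodes — port (S1): `stub_FE` of ⟨stmt-QuantumFields-27930⟩ v3.5 BY NAME from {`stub_P0C`, `stub_G3C`, `FEStepBox`}, and the crux by name from the same three letters
  (cone-side leaf of ✓`…PortS1FEInduction`; porter hand `hand-27930-FE-1` g0, cell `ym-nodeO-ideate`)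

`--supports stmt-QuantumFields-27930` (helper; NO `--workitem`); count-neutral.  [I] = [Balaban1987RG1].

WHAT THIS FILE IS (proofs only, no definitions).  ✓`…PortS1FEInduction` proves, route-independently, `portRecordFEHalfBox_of_lzjac_GL_step : (∀ F, PortRecordLZjacHalf F) → (∀ F, P0HolExtAtRecordGL F)
→ (∀ F, G3CAtRecordL F) → (∀ F, FEStepBox F) → ∀ F, PortRecordFEHalfBox F` (strong induction on the scale, [I] p.268 L27–31).  The δ-Jacobian sub-half `∀ F, PortRecordLZjacHalf F` is a THEOREM of
the tree — ✓`lzjacHalf_of_jacRowsAB_all (jacRowsAB_all_of_kstep_of_dom stub_LZjacKStep stub_LZjacDom)` (module ✓`…PortS1JacGlue`, inside the route file's import cone) — so HERE, on the cone side: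
* ★★★ `stub_FE_of_step : (∀ F, P0HolExtAtRecordGL F) → (∀ F, G3CAtRecordL F) → (∀ F, FEStepBox F) → ∀ F, PortRecordFEHalfBox F` — the REGISTERED STUB's TYPE LITERALLY (skeleton
  `Cruxes/PortRecordRepresentationS1/Lines/pta_residueW.lean` 8e26abbe :103) from the two open LZ letters and the inductive-step letter;
* ★★★ `PortRecordRepresentationS1_of_step : (∀ F, P0HolExtAtRecordGL F) → (∀ F, G3CAtRecordL F) → (∀ F, FEStepBox F) → Theses.BalabanUVNodes.PortRecordRepresentationS1` — the crux BY NAME, by the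
  skeleton's own composition ✓`sig27930v8LR4_of_dom_kstep stub_LZjacDom stub_LZjacKStep (lzdetHalf_of_twin_GL · (stub_LZdetTwin ·) · ·) (portRecordFEHalf_of_box · ·)` with `stub_FE_of_step` in the FE slot
  (= `PtaResidueW.PortRecordRepresentationS1_of hP0C hG3C (stub_FE_of_step hP0C hG3C hStep)`; the Lines file is byte-frozen and NOT edited);
* `sig8LR4Box_of_step` — the box edition of ⁸ for every `F` from the same three letters.

HONEST STATUS.  Kernel bookkeeping over OPEN letters: `stub_P0C` (`P0HolExtAtRecordGL`, P0-class), `stub_G3C`'s statement `G3CAtRecordL` (closed by name ✓p824985 — taken here as a hypothesis so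
the file does not depend on that landing's module), `FEStepBox` (XXL, inhabited nowhere); NOTHING of Bałaban asserted, ported, discharged or refuted; `stub_FE` NOT closed; ⟨27930⟩ OPEN (1∕3);
NODE O 0∕1; COUNT 8∕28 · K 1∕4 UNMOVED; finite 𝕋⁴_{L^K} at fixed ε — NOT continuum ∕ OS ∕ Clay; **the Yang–Mills mass gap (Clay) is NOT proved by any of this.**  No `sorry`; standard axioms.

References: T. Bałaban, *Renormalization group approach to lattice gauge field theories. I*, Comm. Math. Phys. 109 (1987) 249–301 [Balaban1987RG1] — Thm 3 p.264, (2.12)–(2.14) p.268, p.268 L27–31.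
-/

noncomputable section

namespace Summit.QuantumFields.YangMills.Theorems.BalabanUVNodesPortS1

open Summit.QuantumFields.YangMills.Theorems.K0RecordFormatNames
open Literature.MathematicalPhysics.QuantumFieldTheory.Balaban1983to89
open Literature.MathematicalPhysics.QuantumFieldTheory.Balaban1983to89.T4Continuum (T4Family)

/-- **The δ-Jacobian sub-half for every torus family — a theorem of the tree** (gen 6∕7 of the porter lineage: ✓`stub_LZjacKStep`, ✓`stub_LZjacDom`, glued by ✓`jacRowsAB_all_of_kstep_of_dom` and
✓`lzjacHalf_of_jacRowsAB_all`). [cite: Balaban1987RG1, (1.4) p.260, p.267–268 («h(c)»), (1.18) p.263] -/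
theorem lzjacHalf_all : ∀ F : T4Family, PortRecordLZjacHalf F :=
  lzjacHalf_of_jacRowsAB_all (jacRowsAB_all_of_kstep_of_dom stub_LZjacKStep stub_LZjacDom)

/-- ★★★ **`stub_FE` BY NAME FROM THREE LETTERS**: the P0-ℂ letter, the G3C letter and the inductive step `FEStepBox` give `∀ F, PortRecordFEHalfBox F` — the REGISTERED STUB's TYPE LITERALLY
(⟨27930⟩ v3.5 `pta_residueW.lean` :103).  CONDITIONAL; `P0HolExtAtRecordGL` and `FEStepBox` inhabited nowhere; nothing asserted. [cite: Balaban1987RG1, Thm 3 p.264, (2.12)–(2.14) p.268, p.268 L27–31] -/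
theorem stub_FE_of_step (hP0C : ∀ F, P0HolExtAtRecordGL F) (hG3C : ∀ F, G3CAtRecordL F) (hS : ∀ F, FEStepBox F) :
    ∀ F, Summit.QuantumFields.YangMills.Theorems.BalabanUVNodesPortS1.PortRecordFEHalfBox F :=
  portRecordFEHalfBox_of_lzjac_GL_step lzjacHalf_all hP0C hG3C hS

/-- ★★★ **THE CRUX BY NAME FROM {`stub_P0C`, `stub_G3C`, `FEStepBox`}** — the skeleton's composition (✓`sig27930v8LR4_of_dom_kstep` on the landed δ-Jacobian stubs, the landed integer twin + ✓`lzdetHalf_of_twin_GL`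
in the Gaussian slot, ✓`portRecordFEHalf_of_box ∘ stub_FE_of_step` in the FE slot); conclusion = the route decl `Theses.BalabanUVNodes.PortRecordRepresentationS1`.  CONDITIONAL; nothing asserted.
[cite: Balaban1987RG1, Thm 3 p.264, (1.6)–(1.21) pp.261–264, (2.12)–(2.14) p.268] -/
theorem PortRecordRepresentationS1_of_step (hP0C : ∀ F, P0HolExtAtRecordGL F) (hG3C : ∀ F, G3CAtRecordL F) (hS : ∀ F, FEStepBox F) :
    Summit.QuantumFields.YangMills.Theses.BalabanUVNodes.PortRecordRepresentationS1 :=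
  sig27930v8LR4_of_dom_kstep stub_LZjacDom stub_LZjacKStep
    (fun F => lzdetHalf_of_twin_GL F (stub_LZdetTwin F) (hP0C F) (hG3C F))
    (fun F => portRecordFEHalf_of_box F (stub_FE_of_step hP0C hG3C hS F))

/-- **The box edition of ⁸ for every torus family from the same three letters** (✓`sig8LR4Box_of_lzjac_GL_step`). CONDITIONAL bookkeeping. [cite: Balaban1987RG1, Thm 3 p.264, (1.18)–(1.22) pp.263–264] -/
theorem sig8LR4Box_of_step (hP0C : ∀ F, P0HolExtAtRecordGL F) (hG3C : ∀ F, G3CAtRecordL F) (hS : ∀ F, FEStepBox F) : ∀ F, Sig8LR4Box F :=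
  sig8LR4Box_of_lzjac_GL_step lzjacHalf_all hP0C hG3C hS

-- standard axioms only
#print axioms stub_FE_of_step
#print axioms PortRecordRepresentationS1_of_step

end Summit.QuantumFields.YangMills.Theorems.BalabanUVNodesPortS1

end
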